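import Literature.NumberTheory.Rogawski1990.SplitSingularRegularity
import Literature.NumberTheory.Rogawski1990.AdelicStableClassSupportFiniteSemisimple
import Literature.NumberTheory.Rogawski1990.KottwitzSignCM
import HarnessLib

/-!
# The anchored `SJ_G` datum of the stabilised trace formula, by trichotomy on the stable classes
(Rogawski, *Automorphic Representations of Unitary Groups in Three Variables* (1990), Thm. 14.5.1 (a) p. 238, Prop. 10.1.2 p. 146,
§4.1 (4.1.2) pp. 39–40, §5.4 (5.4.3) pp. 72–73)

Topic `NumberTheory/Rogawski1990`; namespace `Literature.NumberTheory.Rogawski1990`; DEFINITIONS WITH BODIES + proved lemmas (no named fact, no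
instance, no notation, no `sorry`).  Cell `pub/hodgecm-mathlib`, ENGINE T1 (crux H413 = `stmt-HodgeConjecture-24833`), row O7 «singular semisimple
classes», LEAD RULING #118 (LEAVES-FIRST): the VALUE FUNCTION behind the engine's anchored `SJ_G` and its four evaluations live here, kit-free, so that
the engine workfile only carries the pin texts and ≤ 10-line anchors.  For the anisotropic inner form `G′ = U(H)` and the quasi-split `G = U(Φ₃)`,
`Φ₃ = antidiag(1,1,1)`, and a stable class `𝒪` of `G′(L⁺)`:

* `centralScalarG hdet 𝒪` — the rational scalar `ζ•1 ∈ U(Φ₃)(L⁺)` of a CENTRAL class `𝒪 = 𝒪_st(ζ•1)` (junk `1` otherwise);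
  `coe_centralScalarG`, `centralScalarG_eq_of_coe_eq_smul_one`;
* **`anchoredSJG hdet α κG m 𝒪 f`** — `SJ_G(𝒪, f)` by TRICHOTOMY [Thm. 14.5.1 (a); Prop. 10.1.2 (b)]: REGULAR `𝒪 = 𝒪_st(γ₀)`:
  `α(𝒪) · κ_G(𝒪) · Φ^{st,𝐀}_G(γ₀; m; f)` (★ `adelicStableOrbitalIntegralG`); CENTRAL `𝒪 = 𝒪_st(ζ•1)`: `α(𝒪) · f(ζ•1 ⊗ 1)`; split-SINGULAR non-central
  `𝒪` (`(γ₀ − a)(γ₀ − b) = 0`, `a ≠ b`): `(α(𝒪)∕2) · Φ^{e,𝐀}_G(γ₀; m; f)`, the adelic stable sum SIGNED by the Kottwitz signs ★ `kottwitzSignWeight L 3 Φ₃`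
  [§4.1 (4.1.2): at a non-regular semisimple class the stable orbital integral carries `e(G_{γ′})`]; `0` at the remaining classes;
* `anchoredSJG_eq_of_isRegularElt`, `anchoredSJG_eq_of_coe_eq_smul_one`, **`anchoredSJG_eq_of_mul_sub_smul_eq_zero`** — the three evaluations
  at ANY rational representative of the class (R-INV ★ `adelicStableOrbitalIntegralG_eq_of_isStablyConj` ∕ ★ `adelicKappaOrbitalIntegralG_eq_of_isStablyConj`);
* **`finite_support_anchoredSJG`** — for `f` of compact support, `𝒪 ↦ SJ_G(𝒪, f)` has finite support (★ K6-γ `finite_setOf_stableClass_meets_of_anisotropic`).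

The weights `α`, `κ_G` and the adelic orbital measure family `m` on `U(Φ₃)(𝐀)` are PARAMETERS (the engine instantiates them with its anchored data).
HC_CM is proved only modulo the printed citations until rung 0 closes; this file consumes none of them.

## References
* [Rogawski1990] J. D. Rogawski, *Automorphic Representations of Unitary Groups in Three Variables*, Ann. of Math. Stud. 123 (1990), Thm. 14.5.1 (a)
  p. 238; Prop. 10.1.2 p. 146; §4.1 (4.1.2) pp. 39–40; §5.4 (5.4.3) pp. 72–73; §14.5 pp. 237–239.
* [Kottwitz1983] R. E. Kottwitz, *Sign changes in harmonic analysis on reductive groups*, Trans. AMS 278 (1983), 289–297.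
-/

set_option autoImplicit false

noncomputable section

open MeasureTheory NumberField IsDedekindDomain Matrix
open scoped MatrixGroups

namespace Literature.NumberTheory.Rogawski1990

open Literature.NumberTheory.Automorphic
open Literature.AlgebraicGeometry.ShimuraVarieties (unitaryGroup hermForm)

section AnchoredStableSJG

variable {L : Type} [Field L] [NumberField L] [IsCMField L] {H : Matrix (Fin 3) (Fin 3) L}

/-! ## §1 The rational scalar of `U(Φ₃)` attached to a central class -/

/-- **The rational scalar `ζ•1 ∈ U(Φ₃)(L⁺)` of a CENTRAL stable class** `𝒪 = 𝒪_st(ζ•1)` of `U(H)(L⁺)` (by choice: the chosen representative of `𝒪`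
is then `ζ•1` itself, `ζ` of norm one, and ★ `exists_rational_antidiagThree_coe_eq_smul_one` puts `ζ•1` in the quasi-split group); the junk value
`1` at a non-central class. [cite: Rogawski1990, Prop. 10.1.2 (b)(2) p. 146] -/
def centralScalarG (hdet : H.det ≠ 0) (𝒪 : StableClass (cmConjRingHom L) H) :
    (UnitaryGroup.cmDatum L 3 (Matrix.of fun i j : Fin 3 => if i.val + j.val + 1 = 3 then (1 : L) else 0)).Rational :=
  open scoped Classical in
  if hc : ∃ ζ : L, (((Quotient.out (s := stableConjSetoid _ _) 𝒪 : (UnitaryGroup.cmDatum L 3 H).Rational).val : GL (Fin 3) L) :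
      Matrix (Fin 3) (Fin 3) L) = ζ • (1 : Matrix (Fin 3) (Fin 3) L) then
    (exists_rational_antidiagThree_coe_eq_smul_one (L := L)
      (conj_mul_self_eq_one_of_smul_one_mem hdet (Quotient.out (s := stableConjSetoid _ _) 𝒪).2 hc.choose_spec)).choose
  else 1

/-- The matrix of `centralScalarG` at a central class is the chosen scalar. [cite: Rogawski1990, Prop. 10.1.2 (b)(2) p. 146] -/
theorem coe_centralScalarG (hdet : H.det ≠ 0) {𝒪 : StableClass (cmConjRingHom L) H}
    (hc : ∃ ζ : L, (((Quotient.out (s := stableConjSetoid _ _) 𝒪 : (UnitaryGroup.cmDatum L 3 H).Rational).val : GL (Fin 3) L) :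
      Matrix (Fin 3) (Fin 3) L) = ζ • (1 : Matrix (Fin 3) (Fin 3) L)) :
    (((centralScalarG hdet 𝒪).val : GL (Fin 3) L) : Matrix (Fin 3) (Fin 3) L) = hc.choose • (1 : Matrix (Fin 3) (Fin 3) L) := by
  classical
  unfold centralScalarG
  rw [dif_pos hc]
  exact (exists_rational_antidiagThree_coe_eq_smul_one (L := L)
    (conj_mul_self_eq_one_of_smul_one_mem hdet (Quotient.out (s := stableConjSetoid _ _) 𝒪).2 hc.choose_spec)).choose_spec

/-- **`centralScalarG (𝒪_st(ζ•1)) = ζ•1`**: at the class of a central `γ₀ = ζ•1 ∈ U(H)(L⁺)`, `centralScalarG` is THE element of `U(Φ₃)(L⁺)` with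
matrix `ζ•1` (a scalar is stably conjugate only to itself, ★ `coe_eq_smul_one_of_isStablyConj_smul_one`). [cite: Rogawski1990, Prop. 10.1.2 (b)(2) p. 146] -/
theorem centralScalarG_eq_of_coe_eq_smul_one (hdet : H.det ≠ 0) {𝒪 : StableClass (cmConjRingHom L) H}
    {γ₀ : (UnitaryGroup.cmDatum L 3 H).Rational}
    {γ : (UnitaryGroup.cmDatum L 3 (Matrix.of fun i j : Fin 3 => if i.val + j.val + 1 = 3 then (1 : L) else 0)).Rational} {ζ : L}
    (he : 𝒪 = stableClassOf (cmConjRingHom L) H γ₀)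
    (hζ : ((γ₀.val : GL (Fin 3) L) : Matrix (Fin 3) (Fin 3) L) = ζ • (1 : Matrix (Fin 3) (Fin 3) L))
    (hγ : ((γ.val : GL (Fin 3) L) : Matrix (Fin 3) (Fin 3) L) = ζ • (1 : Matrix (Fin 3) (Fin 3) L)) :
    centralScalarG hdet 𝒪 = γ := by
  have hout : (((Quotient.out (s := stableConjSetoid _ _) 𝒪 : (UnitaryGroup.cmDatum L 3 H).Rational).val : GL (Fin 3) L) :
      Matrix (Fin 3) (Fin 3) L) = ζ • (1 : Matrix (Fin 3) (Fin 3) L) :=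
    coe_eq_smul_one_of_isStablyConj_smul_one (isStablyConj_out_of_eq he) hζ
  have hc : ∃ ζ' : L, (((Quotient.out (s := stableConjSetoid _ _) 𝒪 : (UnitaryGroup.cmDatum L 3 H).Rational).val : GL (Fin 3) L) :
      Matrix (Fin 3) (Fin 3) L) = ζ' • (1 : Matrix (Fin 3) (Fin 3) L) := ⟨ζ, hout⟩
  have hζ' : hc.choose = ζ := by
    have h2 : hc.choose • (1 : Matrix (Fin 3) (Fin 3) L) = ζ • (1 : Matrix (Fin 3) (Fin 3) L) := hc.choose_spec.symm.trans hout
    simpa using congrArg (fun M : Matrix (Fin 3) (Fin 3) L => M 0 0) h2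
  apply Subtype.ext
  apply Units.ext
  rw [coe_centralScalarG hdet hc, hγ, hζ']

/-! ## §2 The anchored `SJ_G` by trichotomy -/

section Value

variable [∀ g : (UnitaryGroup.cmDatum L 3 (Matrix.of fun i j : Fin 3 => if i.val + j.val + 1 = 3 then (1 : L) else 0)).Adelic,
  MeasurableSpace ((UnitaryGroup.cmDatum L 3 (Matrix.of fun i j : Fin 3 => if i.val + j.val + 1 = 3 then (1 : L) else 0)).Adelic ⧸
    Subgroup.centralizer ({g} : Set (UnitaryGroup.cmDatum L 3 (Matrix.of fun i j : Fin 3 => if i.val + j.val + 1 = 3 then (1 : L) else 0)).Adelic))]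

/-- **THE ANCHORED `SJ_G` DATUM, by TRICHOTOMY on the stable class `𝒪` of `G′(L⁺)`** (weights `α`, `κ_G` and the adelic orbital measure family `m`
on `U(Φ₃)(𝐀)` are parameters; values are read at the chosen representative `out 𝒪` and are representative-free by §3): REGULAR `𝒪`:
`α(𝒪) · κ_G(𝒪) · Φ^{st,𝐀}_G(out 𝒪; m; f)` [Thm. 14.5.1 (a); (5.4.3)]; CENTRAL `𝒪 = 𝒪_st(ζ•1)`: `α(𝒪) · f(ζ•1 ⊗ 1)` [Prop. 10.1.2 (b)(2)];
split-SINGULAR non-central `𝒪`: `(α(𝒪)∕2) · Φ^{e,𝐀}_G(out 𝒪; m; f)` with the Kottwitz-SIGNED adelic stable sum ★ `adelicKappaOrbitalIntegralG …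
(kottwitzSignWeight L 3 Φ₃)` [Prop. 10.1.2 (b)(1); §4.1 (4.1.2)]; `0` at every other class (none is semisimple; for the anisotropic `G′` there are none).
[cite: Rogawski1990, Thm. 14.5.1 (a) p. 238; Prop. 10.1.2 p. 146; §4.1 (4.1.2) pp. 39–40; §5.4 (5.4.3) pp. 72–73] -/
def anchoredSJG (hdet : H.det ≠ 0) (α κG : StableClass (cmConjRingHom L) H → ℝ)
    (m : OrbitalMeasureFamily (UnitaryGroup.cmDatum L 3 (Matrix.of fun i j : Fin 3 => if i.val + j.val + 1 = 3 then (1 : L) else 0)).Adelic)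
    (𝒪 : StableClass (cmConjRingHom L) H)
    (f : (UnitaryGroup.cmDatum L 3 (Matrix.of fun i j : Fin 3 => if i.val + j.val + 1 = 3 then (1 : L) else 0)).Adelic → ℂ) : ℂ :=
  open scoped Classical in
  if 𝒪.IsRegular then
    ((α 𝒪 * κG 𝒪 : ℝ) : ℂ) * adelicStableOrbitalIntegralG L H (Quotient.out (s := stableConjSetoid _ _) 𝒪) m f
  else if ∃ ζ : L, (((Quotient.out (s := stableConjSetoid _ _) 𝒪 : (UnitaryGroup.cmDatum L 3 H).Rational).val : GL (Fin 3) L) :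
      Matrix (Fin 3) (Fin 3) L) = ζ • (1 : Matrix (Fin 3) (Fin 3) L) then
    ((α 𝒪 : ℝ) : ℂ) *
      f ((UnitaryGroup.cmDatum L 3 (Matrix.of fun i j : Fin 3 => if i.val + j.val + 1 = 3 then (1 : L) else 0)).toAdelic (centralScalarG hdet 𝒪))
  else if ∃ a b : L, a ≠ b ∧
      ((((Quotient.out (s := stableConjSetoid _ _) 𝒪 : (UnitaryGroup.cmDatum L 3 H).Rational).val : GL (Fin 3) L) : Matrix (Fin 3) (Fin 3) L) -
          a • (1 : Matrix (Fin 3) (Fin 3) L)) *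
        ((((Quotient.out (s := stableConjSetoid _ _) 𝒪 : (UnitaryGroup.cmDatum L 3 H).Rational).val : GL (Fin 3) L) : Matrix (Fin 3) (Fin 3) L) -
          b • (1 : Matrix (Fin 3) (Fin 3) L)) = 0 then
    ((α 𝒪 / 2 : ℝ) : ℂ) *
      adelicKappaOrbitalIntegralG L H (Quotient.out (s := stableConjSetoid _ _) 𝒪)
        (kottwitzSignWeight L 3 (Matrix.of fun i j : Fin 3 => if i.val + j.val + 1 = 3 then (1 : L) else 0)) m f
  else 0

/-! ## §3 The three evaluations, at any rational representative -/

/-- **REGULAR classes**: at `𝒪 = 𝒪_st(γ₀)` with `γ₀` regular, `SJ_G(𝒪, f) = α(𝒪) · κ_G(𝒪) · Φ^{st,𝐀}_G(γ₀; m; f)` (R-INV ★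
`adelicStableOrbitalIntegralG_eq_of_isStablyConj`). [cite: Rogawski1990, Thm. 14.5.1 (a) p. 238; §5.4 (5.4.3) pp. 72–73] -/
theorem anchoredSJG_eq_of_isRegularElt (hdet : H.det ≠ 0) (α κG : StableClass (cmConjRingHom L) H → ℝ)
    (m : OrbitalMeasureFamily (UnitaryGroup.cmDatum L 3 (Matrix.of fun i j : Fin 3 => if i.val + j.val + 1 = 3 then (1 : L) else 0)).Adelic)
    {𝒪 : StableClass (cmConjRingHom L) H} {γ₀ : (UnitaryGroup.cmDatum L 3 H).Rational}
    (he : 𝒪 = stableClassOf (cmConjRingHom L) H γ₀) (hreg : IsRegularElt (γ₀.val : GL (Fin 3) L))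
    (f : (UnitaryGroup.cmDatum L 3 (Matrix.of fun i j : Fin 3 => if i.val + j.val + 1 = 3 then (1 : L) else 0)).Adelic → ℂ) :
    anchoredSJG hdet α κG m 𝒪 f = ((α 𝒪 * κG 𝒪 : ℝ) : ℂ) * adelicStableOrbitalIntegralG L H γ₀ m f := by
  classical
  have hR : 𝒪.IsRegular := StableClass.isRegular_of_eq_stableClassOf he hreg
  unfold anchoredSJG
  rw [if_pos hR]
  congr 1
  exact adelicStableOrbitalIntegralG_eq_of_isStablyConj L H (isStablyConj_out_of_eq he) _ _

/-- **CENTRAL classes**: at `𝒪 = 𝒪_st(γ₀)` with `γ₀ = ζ•1`, and `γ ∈ U(Φ₃)(L⁺)` the scalar `ζ•1`, `SJ_G(𝒪, f) = α(𝒪) · f(γ ⊗ 1)`.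
[cite: Rogawski1990, Prop. 10.1.2 (b)(2) p. 146; §14.5 p. 239] -/
theorem anchoredSJG_eq_of_coe_eq_smul_one (hdet : H.det ≠ 0) (α κG : StableClass (cmConjRingHom L) H → ℝ)
    (m : OrbitalMeasureFamily (UnitaryGroup.cmDatum L 3 (Matrix.of fun i j : Fin 3 => if i.val + j.val + 1 = 3 then (1 : L) else 0)).Adelic)
    {𝒪 : StableClass (cmConjRingHom L) H} {γ₀ : (UnitaryGroup.cmDatum L 3 H).Rational}
    {γ : (UnitaryGroup.cmDatum L 3 (Matrix.of fun i j : Fin 3 => if i.val + j.val + 1 = 3 then (1 : L) else 0)).Rational} {ζ : L}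
    (he : 𝒪 = stableClassOf (cmConjRingHom L) H γ₀)
    (hζ : ((γ₀.val : GL (Fin 3) L) : Matrix (Fin 3) (Fin 3) L) = ζ • (1 : Matrix (Fin 3) (Fin 3) L))
    (hγ : ((γ.val : GL (Fin 3) L) : Matrix (Fin 3) (Fin 3) L) = ζ • (1 : Matrix (Fin 3) (Fin 3) L))
    (f : (UnitaryGroup.cmDatum L 3 (Matrix.of fun i j : Fin 3 => if i.val + j.val + 1 = 3 then (1 : L) else 0)).Adelic → ℂ) :
    anchoredSJG hdet α κG m 𝒪 f =
      ((α 𝒪 : ℝ) : ℂ) * f ((UnitaryGroup.cmDatum L 3 (Matrix.of fun i j : Fin 3 => if i.val + j.val + 1 = 3 then (1 : L) else 0)).toAdelic γ) := by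
  classical
  have hout : (((Quotient.out (s := stableConjSetoid _ _) 𝒪 : (UnitaryGroup.cmDatum L 3 H).Rational).val : GL (Fin 3) L) :
      Matrix (Fin 3) (Fin 3) L) = ζ • (1 : Matrix (Fin 3) (Fin 3) L) :=
    coe_eq_smul_one_of_isStablyConj_smul_one (isStablyConj_out_of_eq he) hζ
  have hnR : ¬ 𝒪.IsRegular := by
    rw [he, StableClass.isRegular_stableClassOf]
    exact not_isRegularElt_of_coe_eq_smul_one γ₀ hζ
  have hc : ∃ ζ' : L, (((Quotient.out (s := stableConjSetoid _ _) 𝒪 : (UnitaryGroup.cmDatum L 3 H).Rational).val : GL (Fin 3) L) :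
      Matrix (Fin 3) (Fin 3) L) = ζ' • (1 : Matrix (Fin 3) (Fin 3) L) := ⟨ζ, hout⟩
  unfold anchoredSJG
  rw [if_neg hnR, if_pos hc, centralScalarG_eq_of_coe_eq_smul_one hdet he hζ hγ]

/-- **Split-SINGULAR non-central classes**: at `𝒪 = 𝒪_st(γ₀)` with `(γ₀ − a)(γ₀ − b) = 0`, `a ≠ b`, `γ₀` not a scalar (`H` hermitian),
`SJ_G(𝒪, f) = (α(𝒪)∕2) · Φ^{e,𝐀}_G(γ₀; m; f)`, the Kottwitz-SIGNED adelic stable sum (the representative `out 𝒪` is split-singular for the same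
pair, ★ `mul_sub_smul_one_eq_zero_of_isConj`, and not regular, ★ `not_isRegularElt_of_mul_sub_eq_zero`; weighted R-INV ★
`adelicKappaOrbitalIntegralG_eq_of_isStablyConj`). [cite: Rogawski1990, Prop. 10.1.2 (b)(1) p. 146; §4.1 (4.1.2) pp. 39–40; §14.5 p. 239] -/
theorem anchoredSJG_eq_of_mul_sub_smul_eq_zero (hH : (H.map (cmConjRingHom L)).transpose = H) (hdet : H.det ≠ 0)
    (α κG : StableClass (cmConjRingHom L) H → ℝ)
    (m : OrbitalMeasureFamily (UnitaryGroup.cmDatum L 3 (Matrix.of fun i j : Fin 3 => if i.val + j.val + 1 = 3 then (1 : L) else 0)).Adelic)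
    {𝒪 : StableClass (cmConjRingHom L) H} {γ₀ : (UnitaryGroup.cmDatum L 3 H).Rational} {a b : L}
    (he : 𝒪 = stableClassOf (cmConjRingHom L) H γ₀) (hab : a ≠ b)
    (hγ : (((γ₀.val : GL (Fin 3) L) : Matrix (Fin 3) (Fin 3) L) - a • (1 : Matrix (Fin 3) (Fin 3) L)) *
      (((γ₀.val : GL (Fin 3) L) : Matrix (Fin 3) (Fin 3) L) - b • (1 : Matrix (Fin 3) (Fin 3) L)) = 0)
    (hnc : ¬ ∃ ζ : L, ((γ₀.val : GL (Fin 3) L) : Matrix (Fin 3) (Fin 3) L) = ζ • (1 : Matrix (Fin 3) (Fin 3) L))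
    (f : (UnitaryGroup.cmDatum L 3 (Matrix.of fun i j : Fin 3 => if i.val + j.val + 1 = 3 then (1 : L) else 0)).Adelic → ℂ) :
    anchoredSJG hdet α κG m 𝒪 f = ((α 𝒪 / 2 : ℝ) : ℂ) *
      adelicKappaOrbitalIntegralG L H γ₀
        (kottwitzSignWeight L 3 (Matrix.of fun i j : Fin 3 => if i.val + j.val + 1 = 3 then (1 : L) else 0)) m f := by
  classical
  have hst := isStablyConj_out_of_eq he
  have hγ' : ((((Quotient.out (s := stableConjSetoid _ _) 𝒪 : (UnitaryGroup.cmDatum L 3 H).Rational).val : GL (Fin 3) L) :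
      Matrix (Fin 3) (Fin 3) L) - a • (1 : Matrix (Fin 3) (Fin 3) L)) *
      ((((Quotient.out (s := stableConjSetoid _ _) 𝒪 : (UnitaryGroup.cmDatum L 3 H).Rational).val : GL (Fin 3) L) :
      Matrix (Fin 3) (Fin 3) L) - b • (1 : Matrix (Fin 3) (Fin 3) L)) = 0 :=
    mul_sub_smul_one_eq_zero_of_isConj hst.symm hγ
  have hnc' : ¬ ∃ ζ : L, (((Quotient.out (s := stableConjSetoid _ _) 𝒪 : (UnitaryGroup.cmDatum L 3 H).Rational).val : GL (Fin 3) L) :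
      Matrix (Fin 3) (Fin 3) L) = ζ • (1 : Matrix (Fin 3) (Fin 3) L) := by
    rintro ⟨ζ, hζ⟩
    exact hnc ⟨ζ, coe_eq_smul_one_of_isStablyConj_smul_one hst.symm hζ⟩
  have hnR : ¬ 𝒪.IsRegular := by
    rw [he, StableClass.isRegular_stableClassOf]
    exact not_isRegularElt_of_mul_sub_eq_zero hH hdet γ₀ hab hγ hnc
  have hS : ∃ a' b' : L, a' ≠ b' ∧
      ((((Quotient.out (s := stableConjSetoid _ _) 𝒪 : (UnitaryGroup.cmDatum L 3 H).Rational).val : GL (Fin 3) L) : Matrix (Fin 3) (Fin 3) L) -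
          a' • (1 : Matrix (Fin 3) (Fin 3) L)) *
        ((((Quotient.out (s := stableConjSetoid _ _) 𝒪 : (UnitaryGroup.cmDatum L 3 H).Rational).val : GL (Fin 3) L) : Matrix (Fin 3) (Fin 3) L) -
          b' • (1 : Matrix (Fin 3) (Fin 3) L)) = 0 := ⟨a, b, hab, hγ'⟩
  unfold anchoredSJG
  rw [if_neg hnR, if_neg hnc', if_pos hS]
  congr 1
  exact adelicKappaOrbitalIntegralG_eq_of_isStablyConj hst _ _ _

/-! ## §4 Finite support in the stable class -/

/-- **`𝒪 ↦ SJ_G(𝒪, f)` HAS FINITE SUPPORT** for `f` of compact support on `U(Φ₃)(𝐀)` and the anisotropic `G′`: every non-zero branch of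
`anchoredSJG` forces the adelic stable class `𝒞_𝐀(out 𝒪)` to MEET `tsupport f` (a non-vanishing class orbital integral, resp. the central point
`ζ•1 ⊗ 1 ∈ tsupport f`, whose class lies in `𝒞_𝐀(ζ•1)`), and only finitely many stable classes do (★ K6-γ `finite_setOf_stableClass_meets_of_anisotropic`).
[cite: Rogawski1990, §14.5 p. 238; §4.3 p. 44; §5.4 (5.4.3) pp. 72–73] -/
theorem finite_support_anchoredSJG (hanis : ∀ x : Fin 3 → L, hermForm (cmConjRingHom L) H x x = 0 → x = 0) (hdet : H.det ≠ 0)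
    (α κG : StableClass (cmConjRingHom L) H → ℝ)
    (m : OrbitalMeasureFamily (UnitaryGroup.cmDatum L 3 (Matrix.of fun i j : Fin 3 => if i.val + j.val + 1 = 3 then (1 : L) else 0)).Adelic)
    {f : (UnitaryGroup.cmDatum L 3 (Matrix.of fun i j : Fin 3 => if i.val + j.val + 1 = 3 then (1 : L) else 0)).Adelic → ℂ}
    (hf : HasCompactSupport f) :
    (Function.support fun 𝒪 => anchoredSJG hdet α κG m 𝒪 f).Finite := by
  classical
  -- a non-zero class orbital integral in `𝒞_𝐀(out 𝒪)` puts `𝒪` in the finite set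
  have key : ∀ (𝒪 : StableClass (cmConjRingHom L) H)
      (c : ConjClasses (UnitaryGroup.cmDatum L 3 (Matrix.of fun i j : Fin 3 => if i.val + j.val + 1 = 3 then (1 : L) else 0)).Adelic),
      c ∈ MatchingAdeleG.classes L H (Quotient.out (s := stableConjSetoid _ _) 𝒪) →
      classOrbitalIntegral m f c ≠ 0 →
      𝒪 ∈ {𝒪 : StableClass (cmConjRingHom L) H |
        ∃ γ₀ : (UnitaryGroup.cmDatum L 3 H).Rational, stableClassOf _ _ γ₀ = 𝒪 ∧
          ∃ c ∈ MatchingAdeleG.classes L H γ₀, ∃ g ∈ tsupport f, ConjClasses.mk g = c} := by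
    intro 𝒪 c hc hne
    refine ⟨_, Quotient.out_eq (s := stableConjSetoid _ _) 𝒪, c, hc, ?_⟩
    by_contra hno
    push Not at hno
    exact hne (classOrbitalIntegral_eq_zero_of_forall_mk_ne m f fun g hg hgc => hno g hg hgc)
  refine (finite_setOf_stableClass_meets_of_anisotropic (H := H) hanis (C := tsupport f) hf).subset fun 𝒪 h𝒪 => ?_
  have h𝒪' : anchoredSJG hdet α κG m 𝒪 f ≠ 0 := h𝒪
  unfold anchoredSJG at h𝒪'
  by_cases hR : 𝒪.IsRegular
  · rw [if_pos hR] at h𝒪'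
    have hne := right_ne_zero_of_mul h𝒪'
    rw [adelicStableOrbitalIntegralG_def] at hne
    obtain ⟨c, hc, hcne⟩ := exists_ne_zero_of_finsum_mem_ne_zero hne
    exact key 𝒪 c hc hcne
  · rw [if_neg hR] at h𝒪'
    by_cases hc : ∃ ζ : L, (((Quotient.out (s := stableConjSetoid _ _) 𝒪 : (UnitaryGroup.cmDatum L 3 H).Rational).val : GL (Fin 3) L) :
        Matrix (Fin 3) (Fin 3) L) = ζ • (1 : Matrix (Fin 3) (Fin 3) L)
    · -- CENTRAL: `f(ζ•1 ⊗ 1) ≠ 0`, and `[ζ•1 ⊗ 1] ∈ 𝒞_𝐀(out 𝒪)` (the scalar corresponds to itself)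
      rw [if_pos hc] at h𝒪'
      have hfz : f ((UnitaryGroup.cmDatum L 3 (Matrix.of fun i j : Fin 3 => if i.val + j.val + 1 = 3 then (1 : L) else 0)).toAdelic
          (centralScalarG hdet 𝒪)) ≠ 0 := right_ne_zero_of_mul h𝒪'
      have hval := coe_centralScalarG hdet hc
      have hcorr : Corresponds (cmConjRingHom L) H (Matrix.of fun i j : Fin 3 => if i.val + j.val + 1 = 3 then (1 : L) else 0)
          (Quotient.out (s := stableConjSetoid _ _) 𝒪) (centralScalarG hdet 𝒪) := by
        have hGL : ((Quotient.out (s := stableConjSetoid _ _) 𝒪 : (UnitaryGroup.cmDatum L 3 H).Rational).val : GL (Fin 3) L) =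
            ((centralScalarG hdet 𝒪).val : GL (Fin 3) L) :=
          Units.ext (hc.choose_spec.trans hval.symm)
        show IsConj _ _
        exact isConj_iff.2 ⟨1, by simpa using hGL⟩
      exact ⟨_, Quotient.out_eq (s := stableConjSetoid _ _) 𝒪, _, MatchingAdeleG.mk_adele_mem_classes (MatchingAdeleG.ofCorresponds hcorr),
        _, subset_tsupport _ (Function.mem_support.2 hfz), rfl⟩
    · rw [if_neg hc] at h𝒪'
      by_cases hS : ∃ a b : L, a ≠ b ∧
          ((((Quotient.out (s := stableConjSetoid _ _) 𝒪 : (UnitaryGroup.cmDatum L 3 H).Rational).val : GL (Fin 3) L) :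
              Matrix (Fin 3) (Fin 3) L) - a • (1 : Matrix (Fin 3) (Fin 3) L)) *
            ((((Quotient.out (s := stableConjSetoid _ _) 𝒪 : (UnitaryGroup.cmDatum L 3 H).Rational).val : GL (Fin 3) L) :
              Matrix (Fin 3) (Fin 3) L) - b • (1 : Matrix (Fin 3) (Fin 3) L)) = 0
      · rw [if_pos hS] at h𝒪'
        have hne := right_ne_zero_of_mul h𝒪'
        rw [adelicKappaOrbitalIntegralG, adelicKappaOrbitalSum_def] at hne
        obtain ⟨c, hc', hcne⟩ := exists_ne_zero_of_finsum_mem_ne_zero hne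
        exact key 𝒪 c hc' (right_ne_zero_of_mul hcne)
      · rw [if_neg hS] at h𝒪'
        exact absurd rfl h𝒪'

end Value

end AnchoredStableSJG

end Literature.NumberTheory.Rogawski1990

end
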